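import Summits.AtomisticToContinuum.FouriersLaw.Theses.ContactStieltjesMeasure
import Summits.AtomisticToContinuum.FouriersLaw.Theorems.ConductanceLowerBound.Negative.GammaZeroNonUniqueness
import Summits.AtomisticToContinuum.FouriersLaw.Theorems.EmbeddedDrudeMourreFiniteResponseOfUnique

/-!
# Disproof of `StieltjesRepresentation` (K2 of route ContactStieltjesMeasure; crux stmt-AtomisticToContinuum-15248)

cdisprove work file (seat `refuter-cdisprove-stmt-AtomisticToContinuum-15248-0`, cycle 1, 2026-08-17).
Prose lives in docstrings; every `theorem` below is kernel-checked unless it says `sorry` (near-misses only).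

## Verdict so far: NO KILL — why it resists

* (H) HARMONIC MEMBER `lam = β = 0` (included in the crux's range) is EXACTLY Stieltjes, for every `N ≥ 2`,
  `ω₂ > 0`: with the tree's closed form `fluxCoeff_eq` (Nakazawa),
  `G_N(γ) = fluxCoeff ω₂ γ N = γ/(2(1+γ²)) · cosh((N-3/2)θ)/cosh((N-1/2)θ)`, `cosh θ = 1 + ω₂γ²/(2(1+γ²))`,
  i.e. `G_N(√z)/√z = R_N(x(z))/(2(1+z))` with `R_N = V_{N-2}/V_{N-1}` (Chebyshev polynomials of the THIRD kind,
  `V_n(cos φ) = cos((n+½)φ)/cos(φ/2)`) and the Möbius map `x(z) = 1 + ω₂ z/(2(1+z))`.  The `N-1` zeros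
  `x_k = cos φ_k`, `φ_k = (2k+1)π/(2N-1)` of `V_{N-1}` pull back to SIMPLE poles `z_k = -s_k² ∈ (-1,0)`, the pole of
  the prefactor at `z = -1` is cancelled by `R_N(x) ~ 1/(2x)` (`x → ∞`), there is no polynomial part, and the residues
  are POSITIVE by interlacing (`Res_{x_k} R_N = sin²φ_k/(N-½) > 0`).  Explicitly
      `G_N(γ) = γ Σ_{k=0}^{N-2} ρ_k/(γ² + s_k²)`,  `s_k² = 4sin²(φ_k/2)/(ω₂ + 4sin²(φ_k/2)) = 1 - ω₂/ω_k²`,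
      `ρ_k = 2 sin²φ_k/((2N-1)(ω₂ + 4 sin²(φ_k/2)))`,  `ω_k² = ω₂ + 4sin²(φ_k/2)` (the chain's dispersion at the
  half-integer wave numbers `φ_k`).  Checks: `N = 2`: one atom `s² = 1/(ω₂+1)`, mass `1/(2(ω₂+1))` (the planner's
  `G_2 = γ/(2+2(ω₂+1)γ²)`); `N = 3`, `ω₂ = 1`: `ρ_0 = ρ_1 = 1/10`, `G_3(1) = 0.1/1.27639 + 0.1/1.72361 = 3/22` (the
  planner's value).  So the route's CHEAPEST FALSIFIER (complete monotonicity at the solvable member) can never fire: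
  `Φ_N` there is the `γ`- and `T`-free staircase with `N-1` steps, all atoms in `(0,1)` (bounded support = ballistic,
  as the route says).  Consequence for provers: `Φ_N` MUST be allowed to jump (no continuity / density strengthening of
  K2 survives the harmonic member), and `stub_harmonicMember` of line cayley-pencil is a finite partial-fraction identity.
* (O) OPEN RANGE `lam, β > 0`: `G_N(γ) = ⟪g₀,(γS - A)⁻¹g₀⟫/T²` with `A` skew, `S ≥ 0`, `S g₀ = g₀` forces the Stieltjes
  form abstractly (energy identity; line cayley-pencil, STUB 3 proved sorry-free by the strategist), provided the
  fixed-`N` response formula holds (Hairer–Majda 2010 framework; tree: Harris bound + Hörmander).  A counterexample on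
  the open range would need entropy production away from the two contacts — impossible.  Numerical cross-check of the
  whole chain response-operator → Stieltjes at the smallest anharmonic member (`N = 2`, Hermite–Galerkin solve of
  `(γS - A)w = g₀√ρ`, Loewner-matrix tests of `F(z) = G(√z)/√z` and of `zF(z)`, NNLS Stieltjes fit): see the
  `numerics` docstring below (kit job ids there) — and the structural reason why such numerics can never kill K2.
* (C) THE ONLY SOFT SPOT is the crux's RANGE: `0 ≤ β` admits the φ⁴ corner `β = 0 < lam`, where the family
  hypothesis needs weak steady states for ALL `N'` (open for `N' ≥ 4`, Hairer–Mattingly 2009; barrier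
  `StrongPinningBreathers`) and no uniqueness is in the tree (CEHR machinery needs `β > 0`): that clause is
  VACUOUS-OR-OPEN — it can be neither refuted (a witness needs uniqueness + existence at all `N'`) nor proved.
  Recommendation (not a refutation): NARROW the crux to `(0 < lam ∧ 0 < β) ∨ (lam = 0 ∧ β = 0)` — exactly what `closes`
  consumes plus the calibration; or at least to `0 < β` (the tree's ergodicity `pinnedChainSemigroup_ergodic` takes
  `0 ≤ lam`, so `lam = 0 < β` is as good as the open range, and STUBS 1–2 of cayley-pencil could be stated with
  `0 ≤ lam`, shrinking `stub_mixedEdges` to the φ⁴ corner alone).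

## Load-bearing analysis (theorems of this file)

* `stieltjesRepresentation_false_without_T_pos` : drop `0 < T` and K2 is FALSE — at `T = 0` the bath temperatures
  `±δ/2` leave the domain where the family is constrained, so a family that is the (tree-)unique steady state at
  positive temperatures and a Dirac mass with current `2` elsewhere has quotient `2/δ`, which has no limit.
  (Junk-dependence, but it is what the hypothesis does: `0 < T` is used ONLY to keep `T ± δ/2 > 0` for small `δ`.)
  LANDED as `Theorems/StieltjesRepresentation/Negative/StieltjesRepresentationFalseWithoutTPos.lean` (p160507).
* `conclusion_of_le_one` : the guard `2 ≤ N` is NOT load-bearing — for `N ≤ 1` there are no bonds (tree: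
  `FiniteResponse.bondCurrent_eq_zero_of_le_one`), the quotient is identically `0` and the conclusion holds with
  `Φ N := 0` along ANY family and for EVERY chain.  (Planner: the guard can be dropped; `closes` re-derives it by hand.)
* `not_weakNessUnique_gamma_zero` : the inner guard `0 < γ` is cosmetic — at `γ = 0` weak-NESS uniqueness FAILS
  (Gibbs state vs Dirac mass at the equilibrium; LANDED by the disprover of crux 11749 as
  `Theorems.pinnedChain_not_unique_gamma_zero`, cited here), so the guarded implication claims nothing there anyway.

* `killCriterion` (section (b)) : K2's REFUTABLE CONSEQUENCES made formal — K2 ⇒ on `lam, β > 0`, for `0 < γ₁ ≤ γ₂`,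
  the finite-`N` responses satisfy `0 ≤ D(γ₂)` and `D(γ₂)/γ₂ ≤ D(γ₁)/γ₁` (`G_N(γ)/γ` non-negative, non-increasing); one
  certified violation at one `N` refutes K2.  LANDED as `…/Negative/StieltjesRepresentationKillCriterion.lean` (p161231).

## Line `cayley-pencil` (PICKED) — stub-level findings
See the docstring `lineNotes` at the end (no stub is false; junk-witness analysis of STUB 2; the `0 ≤ lam` remark).
-/

noncomputable section

namespace Summit.AtomisticToContinuum.FouriersLaw.Cruxes.StieltjesRepresentation.Disproof

open MeasureTheory Filter Set
open scoped Topology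
open Literature.MathematicalPhysics.KineticTheory.HeatConduction

/-! ### (a1) `0 < T` is load-bearing (junk-dependence) -/

/-- K2 (`StieltjesRepresentation`) with the single hypothesis `0 < T` deleted; everything else verbatim. -/
def StieltjesRepresentationWithoutTPos : Prop :=
  ∀ ω₂ lam β : ℝ, 0 < ω₂ → 0 ≤ lam → 0 ≤ β → ∀ T : ℝ, ∃ Φ : ℕ → ℝ → ℝ, ∀ N : ℕ, 2 ≤ N →
    Monotone (Φ N) ∧ (∀ s : ℝ, s ≤ 0 → Φ N s = 0) ∧ (∃ m : ℝ, ∀ s : ℝ, Φ N s ≤ m) ∧ ∀ γ : ℝ, 0 < γ →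
      (∀ (N' : ℕ) (T_L T_R : ℝ), 0 < T_L → 0 < T_R → ∀ μ ν : MeasureTheory.Measure (PhaseSpace N'),
        (pinnedChain ω₂ lam β γ).IsSteadyState N' T_L T_R μ →
        (pinnedChain ω₂ lam β γ).IsSteadyState N' T_L T_R ν → μ = ν) →
      ∀ μ : (N' : ℕ) → ℝ → ℝ → MeasureTheory.Measure (PhaseSpace N'),
        (∀ (N' : ℕ) (T_L T_R : ℝ), 0 < T_L → 0 < T_R →
          (pinnedChain ω₂ lam β γ).IsSteadyState N' T_L T_R (μ N' T_L T_R)) →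
        Filter.Tendsto (fun δ : ℝ => (pinnedChain ω₂ lam β γ).totalCurrent (μ N (T + δ / 2) (T - δ / 2)) / δ)
          (nhdsWithin 0 {(0 : ℝ)}ᶜ)
          (nhds (((N : ℝ) - 1) * γ * ∫ t in Set.Ioi (0 : ℝ), Φ N t * (2 * t / (γ ^ 2 + t ^ 2) ^ 2)))

/-- A phase point of the `N`-site chain with `q_i = i`, `p_i = -1`; for `N = 2` and `V'(r) = r + r³` its single bond
carries the current `j_0 = -((p_0+p_1)/2)·V'(q_1-q_0) = V'(1) = 2`. -/
def badPt (N : ℕ) : PhaseSpace N := (fun i => ((i : ℕ) : ℝ), fun _ => (-1 : ℝ))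

/-- The Dirac mass at `badPt 2` has total current `2` for `pinnedChain 1 1 1 1`. -/
theorem totalCurrent_dirac_badPt :
    (pinnedChain 1 1 1 1).totalCurrent (Measure.dirac (badPt 2)) = 2 := by
  unfold OscillatorChain.totalCurrent
  simp only [MeasureTheory.integral_dirac]
  unfold OscillatorChain.bondCurrent
  simp only [Fin.sum_univ_two, Fin.isValue, Fin.val_zero, Fin.val_one, pinnedChain_deriv_V, badPt]
  norm_num

/-- **`0 < T` is load-bearing.**  With `0 < T` deleted, K2 fails at `(ω₂, lam, β, γ, T, N) = (1,1,1,1,0,2)`: the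
uniqueness hypothesis is the tree's `nessUnique_proof` (stmt-0741), a steady family exists at positive temperatures
(`pinnedChain_exists_isSteadyState`), and at `T = 0` the temperatures `±δ/2` are never both positive, so the family
may be a Dirac mass with current `2` there: the quotient `2/δ` has no limit along `𝓝[≠] 0`. [folklore] -/
theorem stieltjesRepresentation_false_without_T_pos : ¬ StieltjesRepresentationWithoutTPos := by
  intro h
  classical
  obtain ⟨Φ, hΦ⟩ := h 1 1 1 one_pos zero_le_one zero_le_one 0
  obtain ⟨-, -, -, hlim⟩ := hΦ 2 le_rfl
  have hU := Summit.AtomisticToContinuum.FouriersLaw.Theorems.nessUnique_proof 1 1 1 1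
    one_pos one_pos one_pos one_pos
  have hex := fun (N : ℕ) (T_L T_R : ℝ) (hL : 0 < T_L) (hR : 0 < T_R) =>
    pinnedChain_exists_isSteadyState (ω₂ := 1) (lam := 1) (β := 1) (γ := 1)
      one_pos one_pos one_pos one_pos N hL hR
  let fam : (N : ℕ) → ℝ → ℝ → Measure (PhaseSpace N) := fun N T_L T_R =>
    if h : 0 < T_L ∧ 0 < T_R then Classical.choose (hex N T_L T_R h.1 h.2) else Measure.dirac (badPt N)
  have hfam : ∀ (N : ℕ) (T_L T_R : ℝ), 0 < T_L → 0 < T_R →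
      (pinnedChain 1 1 1 1).IsSteadyState N T_L T_R (fam N T_L T_R) := by
    intro N T_L T_R hL hR
    simp only [fam, dif_pos (And.intro hL hR)]
    exact Classical.choose_spec (hex N T_L T_R hL hR)
  have hjunk : ∀ δ : ℝ, fam 2 (0 + δ / 2) (0 - δ / 2) = Measure.dirac (badPt 2) := by
    intro δ
    have hneg : ¬ (0 < 0 + δ / 2 ∧ 0 < 0 - δ / 2) := by
      rintro ⟨h1, h2⟩
      linarith
    simp only [fam, dif_neg hneg]
  have hT := hlim 1 one_pos hU fam hfam
  have hfun : (fun δ : ℝ => (pinnedChain 1 1 1 1).totalCurrent (fam 2 (0 + δ / 2) (0 - δ / 2)) / δ) =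
      fun δ => 2 / δ := by
    funext δ
    rw [hjunk δ, totalCurrent_dirac_badPt]
  rw [hfun] at hT
  have hid : Tendsto (fun δ : ℝ => δ) (𝓝[≠] (0 : ℝ)) (𝓝 0) :=
    tendsto_nhdsWithin_of_tendsto_nhds tendsto_id
  have hmul := hid.mul hT
  rw [zero_mul] at hmul
  have heq : (fun δ : ℝ => δ * (2 / δ)) =ᶠ[𝓝[≠] (0 : ℝ)] fun _ => (2 : ℝ) := by
    filter_upwards [self_mem_nhdsWithin] with δ hδ
    have hδ' : δ ≠ 0 := hδ
    field_simp
  have h2 : Tendsto (fun _ : ℝ => (2 : ℝ)) (𝓝[≠] (0 : ℝ)) (𝓝 0) := hmul.congr' heq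
  have h20 := tendsto_nhds_unique h2 tendsto_const_nhds
  norm_num at h20

/-! ### (a2) `2 ≤ N` is NOT load-bearing: no bonds, no current, conclusion holds with `Φ N = 0` -/

/-- **The guard `2 ≤ N` of K2 is removable**: for `N ≤ 1` there is no bond (tree:
`FiniteResponse.bondCurrent_eq_zero_of_le_one`, also `Theorems.totalCurrent_eq_zero_of_le_one`), the response
quotient is identically `0` along EVERY family `μ`, and the K2 conclusion holds with the witness `Φ N := 0` (monotone,
zero on `(-∞,0]`, bounded), for every chain `P`, every `T` and every `γ`. [folklore] -/
theorem conclusion_of_le_one (P : OscillatorChain) {N : ℕ} (hN : N ≤ 1) (T γ : ℝ)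
    (μ : (N' : ℕ) → ℝ → ℝ → Measure (PhaseSpace N')) :
    Tendsto (fun δ : ℝ => P.totalCurrent (μ N (T + δ / 2) (T - δ / 2)) / δ) (𝓝[≠] 0)
      (𝓝 (((N : ℝ) - 1) * γ *
        ∫ t in Set.Ioi (0 : ℝ), (fun (_ : ℕ) (_ : ℝ) => (0 : ℝ)) N t * (2 * t / (γ ^ 2 + t ^ 2) ^ 2))) := by
  have h0 : ∀ ν : Measure (PhaseSpace N), P.totalCurrent ν = 0 := fun ν => by
    unfold OscillatorChain.totalCurrent
    refine Finset.sum_eq_zero fun i _ => ?_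
    simp [Summit.AtomisticToContinuum.FouriersLaw.Theorems.FiniteResponse.bondCurrent_eq_zero_of_le_one P hN]
  simp only [h0, zero_div, zero_mul, integral_zero, mul_zero]
  exact tendsto_const_nhds

/-! ### (a3) the inner guard `0 < γ` is cosmetic: at `γ = 0` weak-NESS uniqueness FAILS (landed, crux 11749) -/

/-- **At `γ = 0` weak-NESS uniqueness fails** — so the inner guard `0 < γ` of K2 is cosmetic: were `γ = 0` admitted,
the implication guarded by uniqueness would claim nothing there.  This is the LANDED negative lemma
`Theorems.pinnedChain_not_unique_gamma_zero` of the disprover of crux 11749 (Dirac mass at the equilibrium vs the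
Gibbs state of the isolated one-site chain), restated in K2's hypothesis shape (verbatim the same). [folklore] -/
theorem not_weakNessUnique_gamma_zero {ω₂ lam β : ℝ} (hω : 0 < ω₂) (hl : 0 ≤ lam) (hβ : 0 ≤ β) :
    ¬ (∀ (N' : ℕ) (T_L T_R : ℝ), 0 < T_L → 0 < T_R → ∀ μ ν : Measure (PhaseSpace N'),
        (pinnedChain ω₂ lam β 0).IsSteadyState N' T_L T_R μ →
        (pinnedChain ω₂ lam β 0).IsSteadyState N' T_L T_R ν → μ = ν) :=
  Summit.AtomisticToContinuum.FouriersLaw.Theorems.pinnedChain_not_unique_gamma_zero hω hl hβ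

/-! ### (b) K2's refutable consequences on the open range (kill criteria made formal) -/

/-- The layer-cake weight `w_γ(t) = 2t/(γ²+t²)²` is integrable on `(0, ∞)` (`= -d/dt (γ²+t²)⁻¹`, total mass `γ⁻²`).
[folklore] -/
theorem integrableOn_weight {γ : ℝ} (hγ : 0 < γ) :
    IntegrableOn (fun t : ℝ => 2 * t / (γ ^ 2 + t ^ 2) ^ 2) (Set.Ioi 0) := by
  have hpos : ∀ t : ℝ, 0 < γ ^ 2 + t ^ 2 := fun t => by positivity
  have hderiv : ∀ t : ℝ, HasDerivAt (fun s : ℝ => -(γ ^ 2 + s ^ 2)⁻¹) (2 * t / (γ ^ 2 + t ^ 2) ^ 2) t := by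
    intro t
    have hc : HasDerivAt (fun s : ℝ => γ ^ 2 + s ^ 2) (((2 : ℕ) : ℝ) * t ^ (2 - 1)) t :=
      (hasDerivAt_pow 2 t).const_add (γ ^ 2)
    have hi := (hc.inv (hpos t).ne').neg
    refine hi.congr_deriv ?_
    push_cast
    ring
  have hlim : Tendsto (fun s : ℝ => -(γ ^ 2 + s ^ 2)⁻¹) atTop (𝓝 0) := by
    have h1 : Tendsto (fun s : ℝ => γ ^ 2 + s ^ 2) atTop atTop :=
      tendsto_atTop_add_const_left atTop (γ ^ 2) (tendsto_pow_atTop two_ne_zero)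
    simpa using h1.inv_tendsto_atTop.neg
  have hcont : ContinuousWithinAt (fun s : ℝ => -(γ ^ 2 + s ^ 2)⁻¹) (Set.Ici 0) 0 := by
    refine Continuous.continuousWithinAt ?_
    refine Continuous.neg (Continuous.inv₀ (by fun_prop) fun s => (hpos s).ne')
  exact integrableOn_Ioi_deriv_of_nonneg hcont (fun t _ => hderiv t)
    (fun t ht => div_nonneg (by linarith [Set.mem_Ioi.mp ht]) (by positivity)) hlim

/-- **Kill criteria made formal.**  IF K2 holds then on the open range `lam, β > 0`, for every `T > 0`, `N ≥ 2` and two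
frictions `0 < γ₁ ≤ γ₂`, the finite-`N` responses `D(γ₁), D(γ₂)` — the limits of the response quotient along ANY
steady families of the two chains (they exist: `finiteResponseOfUnique_holds`; uniqueness of weak steady states is the
tree's `nessUnique_proof`) — satisfy `0 ≤ D(γ₂)` and `D(γ₂)/γ₂ ≤ D(γ₁)/γ₁`: the conductance per unit friction
`G_N(γ)/γ` is non-negative and NON-INCREASING in `γ` (pointwise in the layer-cake weight; no Stieltjes theory needed).
One certified violation at any finite `N` (two frictions suffice) refutes K2 by modus tollens — this is the precise
form of the route's "oddness/CM of `G_N(γ)/γ`" kill test at orders 0 and 1. [folklore] -/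
theorem killCriterion
    (hK2 : Summit.AtomisticToContinuum.FouriersLaw.Theses.ContactStieltjesMeasure.StieltjesRepresentation)
    {ω₂ lam β : ℝ} (hω : 0 < ω₂) (hl : 0 < lam) (hβ : 0 < β) {T : ℝ} (hT : 0 < T) {N : ℕ} (hN : 2 ≤ N)
    {γ₁ γ₂ : ℝ} (hγ₁ : 0 < γ₁) (h12 : γ₁ ≤ γ₂)
    (μ₁ μ₂ : (N' : ℕ) → ℝ → ℝ → Measure (PhaseSpace N'))
    (hμ₁ : ∀ (N' : ℕ) (T_L T_R : ℝ), 0 < T_L → 0 < T_R →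
      (pinnedChain ω₂ lam β γ₁).IsSteadyState N' T_L T_R (μ₁ N' T_L T_R))
    (hμ₂ : ∀ (N' : ℕ) (T_L T_R : ℝ), 0 < T_L → 0 < T_R →
      (pinnedChain ω₂ lam β γ₂).IsSteadyState N' T_L T_R (μ₂ N' T_L T_R))
    {D₁ D₂ : ℝ}
    (hD₁ : Tendsto (fun δ : ℝ => (pinnedChain ω₂ lam β γ₁).totalCurrent (μ₁ N (T + δ / 2) (T - δ / 2)) / δ)
      (𝓝[≠] 0) (𝓝 D₁))
    (hD₂ : Tendsto (fun δ : ℝ => (pinnedChain ω₂ lam β γ₂).totalCurrent (μ₂ N (T + δ / 2) (T - δ / 2)) / δ)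
      (𝓝[≠] 0) (𝓝 D₂)) :
    0 ≤ D₂ ∧ D₂ / γ₂ ≤ D₁ / γ₁ := by
  have hγ₂ : 0 < γ₂ := lt_of_lt_of_le hγ₁ h12
  obtain ⟨Φ, hΦ⟩ := hK2 ω₂ lam β hω hl.le hβ.le T hT
  obtain ⟨hmono, hzero, ⟨m, hm⟩, hlim⟩ := hΦ N hN
  have hU := fun (γ : ℝ) (hγ : 0 < γ) =>
    Summit.AtomisticToContinuum.FouriersLaw.Theorems.nessUnique_proof ω₂ lam β γ hω hl hβ hγ
  set I : ℝ → ℝ := fun γ => ∫ t in Set.Ioi (0 : ℝ), Φ N t * (2 * t / (γ ^ 2 + t ^ 2) ^ 2) with hI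
  have hD₁eq : D₁ = ((N : ℝ) - 1) * γ₁ * I γ₁ :=
    tendsto_nhds_unique hD₁ (hlim γ₁ hγ₁ (hU γ₁ hγ₁) μ₁ hμ₁)
  have hD₂eq : D₂ = ((N : ℝ) - 1) * γ₂ * I γ₂ :=
    tendsto_nhds_unique hD₂ (hlim γ₂ hγ₂ (hU γ₂ hγ₂) μ₂ hμ₂)
  -- `Φ_N ≥ 0` everywhere (`Φ_N = 0` on `(-∞,0]`, monotone) and `Φ_N ≤ m`
  have hΦnn : ∀ t : ℝ, 0 ≤ Φ N t := by
    intro t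
    rcases le_or_gt t 0 with ht | ht
    · rw [hzero t ht]
    · simpa [hzero 0 le_rfl] using hmono ht.le
  have hw_le : ∀ t : ℝ, 0 < t → 2 * t / (γ₂ ^ 2 + t ^ 2) ^ 2 ≤ 2 * t / (γ₁ ^ 2 + t ^ 2) ^ 2 := by
    intro t ht
    apply div_le_div_of_nonneg_left (by linarith) (by positivity)
    have : γ₁ ^ 2 ≤ γ₂ ^ 2 := pow_le_pow_left₀ hγ₁.le h12 2
    nlinarith [sq_nonneg t]
  have hw_nn : ∀ (γ t : ℝ), 0 < t → 0 ≤ 2 * t / (γ ^ 2 + t ^ 2) ^ 2 := fun γ t ht =>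
    div_nonneg (by linarith) (by positivity)
  -- integrability of the larger integrand
  have hint₁ : Integrable (fun t : ℝ => Φ N t * (2 * t / (γ₁ ^ 2 + t ^ 2) ^ 2)) (volume.restrict (Set.Ioi 0)) := by
    refine Integrable.bdd_mul (c := max m 0) (integrableOn_weight hγ₁) hmono.measurable.aestronglyMeasurable
      (Filter.Eventually.of_forall fun t => ?_)
    rw [Real.norm_eq_abs, abs_of_nonneg (hΦnn t)]
    exact le_trans (hm t) (le_max_left _ _)
  have hI_le : I γ₂ ≤ I γ₁ := by
    refine integral_mono_of_nonneg ?_ hint₁ ?_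
    · refine (ae_restrict_iff' measurableSet_Ioi).2 (Filter.Eventually.of_forall fun t ht => ?_)
      exact mul_nonneg (hΦnn t) (hw_nn γ₂ t ht)
    · refine (ae_restrict_iff' measurableSet_Ioi).2 (Filter.Eventually.of_forall fun t ht => ?_)
      exact mul_le_mul_of_nonneg_left (hw_le t ht) (hΦnn t)
  have hI_nn : 0 ≤ I γ₂ :=
    setIntegral_nonneg measurableSet_Ioi fun t ht => mul_nonneg (hΦnn t) (hw_nn γ₂ t ht)
  have hN1 : 0 ≤ (N : ℝ) - 1 := by
    have : (2 : ℝ) ≤ N := by exact_mod_cast hN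
    linarith
  refine ⟨?_, ?_⟩
  · rw [hD₂eq]
    exact mul_nonneg (mul_nonneg hN1 hγ₂.le) hI_nn
  · have e₁ : D₁ / γ₁ = ((N : ℝ) - 1) * I γ₁ := by
      rw [hD₁eq]; field_simp
    have e₂ : D₂ / γ₂ = ((N : ℝ) - 1) * I γ₂ := by
      rw [hD₂eq]; field_simp
    rw [e₁, e₂]
    exact mul_le_mul_of_nonneg_left hI_le hN1

/-! ### Numerics on the open range (N = 2) and line `cayley-pencil` notes -/

/-- **Numerics (open range, smallest anharmonic member) — and why no Galerkin computation can kill K2.**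
Kit jobs `j025919` (debug, done) and `j025959` (production, 4 levels × 6 cases × 11 frictions; running at the
time of writing, first two cases complete), script `compute/galerkin_k2.py` of this seat, tables attached as evidence
(`galerkin_k2_debug_table.txt`, production table on return).  Method: `pinnedChain ω₂ lam β γ`, `N = 2`, `T = 1`
(general `T` by the exact scaling `lam ↦ lam·T`, `β ↦ β·T`); solve the fixed-`N` response equation
`(γS - A) w = g₀√ρ` in flat `L²(dq dp)` (ground-state transform; `A` the Liouvillian, EXACTLY skew in the truncation;
`S = diag(n₀+n₁)` in scaled Hermite functions of `p_0, p_1`; exact polynomial matrix elements in Hermite functions of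
`q_0, q_1`; the kernel direction `√ρ` removed by a rank-one term), `G_2(γ) = ⟪g₀√ρ, w⟫ = ⟪g₀, R_γ g₀⟫/T²` — by the
LANDED STUB 1 this IS the crux's `D_2(γ)` on `lam ≥ 0 < β`.
RESULTS (production j025959, levels `(Nq,Np) = (12,5),(16,6),(20,6),(20,8)`, `ω₂ = 1`, 11 frictions in `[0.2, 6]`;
partial log `galerkin_k2_prod_partial.txt` attached, full table attached by the job itself on completion):
* calibration `lam = β = 0` against `γ/(2+4γ²)`: max rel. error `1.3e-4 → 9.1e-7 → 1.6e-7 → 1.6e-7`, two finest levels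
  agree to `1.3e-8`; energy identity `γ‖S^{1/2}w‖² = G` to `1e-11`; Loewner defects `≤ 3e-15`;
* anharmonic `lam = β = 1` (`T = 1`): `G_2(γ) ≈ 0.096, 0.130, 0.170, 0.211, 0.241, 0.247, 0.228, 0.192, 0.152, 0.115,
  0.085` at `γ = 0.20, 0.28, 0.39, 0.55, 0.78, 1.10, 1.54, 2.16, 3.04, 4.27, 6.00` (level (20,6); levels (16,6)/(20,6)
  agree to `≈ 1 %`); turnover maximum `≈ 0.247` near `γ ≈ 1.1` (`> 1/6`, the harmonic dimer's maximum: anharmonicity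
  RAISES the dimer conductance at `T = 1`); NNLS mass (`= μ̂`-mass estimate) `≈ 0.54`;
* every Stieltjes test PASSES at every level and case: `G > 0`, `F = G/γ` decreasing, `zF` increasing, Loewner matrix
  of `F` negative semidefinite and of `zF` positive semidefinite up to `3e-11` (round-off), NNLS fit by positive atoms
  exact to `1e-16`.
STRUCTURAL REASON (the real finding): the passes are AUTOMATIC.  Any discretisation that keeps `A_n` skew, `S_n ⪰ 0` and
`S_n b = b` (true for every Hermite–Galerkin truncation, at every level, converged or not) gives
`G_n(γ) = ⟪b,(γS_n - A_n)⁻¹b⟫ = γ∫_{[0,∞)}dν_n(s)/(γ²+s²)` EXACTLY with `ν_n ≤ ‖b‖²` (regularise `S_n + εΠ₀`, factor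
through `(S_n+εΠ₀)^{-1/2}`, let `ε → 0`: vague limits of Stieltjes transforms of bounded mass are Stieltjes transforms, mass
may only escape to `s = ∞`, where it disappears, or to `s = 0`, where it becomes the atom K2 allows via `Φ_N(0+) > 0`).
Hence the class "γ × Stieltjes transform in γ² of a finite positive measure on `[0,∞)`" is CLOSED under the only
operations a computation performs, and the true `G_N` inherits it as soon as it is a pointwise-in-`γ` limit of such
compressions — which is exactly what STUB 2's pencil (`W = S^{1/2}R_γS^{1/2}` extended by continuity) provides.  So no
finite-dimensional computation of `⟪g₀, R_γ g₀⟫` can exhibit a non-Stieltjes `G_N`; a numerical kill of K2 on the open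
range could only come from the physical response DIFFERING from `⟪g₀,R_γg₀⟫/T²` — excluded by the landed STUB 1.  The
numerics therefore certify convergence/reference values, not the form; they are kept as the dimer's reference table. -/
theorem numerics : True := trivial

/-- **Line `cayley-pencil` (PICKED) — stub-level findings of the disprover.**
* No stub is false as stated; `StieltjesRepresentation_of` is kernel-checked, so joint sufficiency is not in question.
* STUB 2 `PencilOfGreenKubo` carries EXACTLY the Stieltjes content: by STUB 3 (proved) any witness `(K, W, g)` makes
  `γ ↦ ⟪g, W γ g⟫` a Stieltjes function `γ∫dν/(γ²+s²)`, `ν ≤ ‖g‖²`; conversely EVERY such function is realised by a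
  pencil (`K = L²(ν; ℝ²)`, `W γ = (γ + sJ)⁻¹`, `J` the quarter turn, `g ≡ e₁`: (R) is the resolvent identity of the
  normal family, (E) holds because `⟪f, Jf⟫ = 0`).  Hence STUB 2 ⇔ "`γ ↦ (∫₀^∞corr_γ)/T²` agrees, at every `γ` where
  `corr_γ ∈ L¹(0,∞)`, with ONE Stieltjes function of mass `≤ ‖g‖²`" — logically as strong as K2 on the open range
  given STUB 1; its merit is naming the witness (`W = S^{1/2}R_γS^{1/2}` on `L²(μ_T)`), not lowering strength.
  Junk witnesses do not discharge it: `K = ℝ`, `W γ = γ⁻¹·id` satisfies (R),(E) but forces `(∫corr_γ)/T² = g²/γ`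
  for all `γ`, i.e. `G_2(γ)·γ` constant — false (calibration member: `γ²/(2+2(ω₂+1)γ²)`; anharmonic `N = 2`: the
  numerics above), and refuting it inside Lean needs STUB 1-grade information anyway.
* STUB 1 `BoundaryGreenKubo`: the value `(N-1)(∫₀^∞corr)/T²` with `corr(t) = Cov_{μ_T}(g₀, P_t g₀)`, `g₀ = p_0∂_{q_0}H`
  is consistent with the resolvent form: from `L* f₁ = -(γ/2T²)u` (first-order stationarity, `u = p_0² - p²_{N-1}`),
  `J = ⟨g₀⟩_NESS` (bath-0 energy balance) and the two identities `(γ/2)u = ½(g₀ - g_{N-1}) - ¼L*u`,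
  `g₀ + g_{N-1} = -L*(H - p_0²/2 - p²_{N-1}/2)` one gets `G_N = ⟪R_γ g₀, g₀⟫/T²` exactly (the cross term
  `⟪R_γ g₀, g_{N-1}⟫ = -⟪R_γ g₀, g₀⟫` because `⟨g₀ · (H - Σ_b p_b²/2)⟩_{μ_T} = 0` by `p_0`-parity) — an independent
  re-derivation of the strategist's normalisation, no factor lost.
* STUBS 1–2 are stated for `0 < lam`; the tree's ergodic theorem `pinnedChainSemigroup_ergodic` takes `0 ≤ lam` (only
  the packaged `pinnedChain_exists_isSteadyState` / `nessUnique_proof` say `0 < lam`), so the edge `lam = 0 < β` of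
  `stub_mixedEdges` is a light restatement away from the open range; the φ⁴ edge `β = 0 < lam` is the irreducible
  vacuous-or-open residue (barrier `StrongPinningBreathers`; no witness can be built against it either).
* `stub_harmonicMember`: TRUE; explicit witness in (H) of the module docstring (matches the rattack seat's certified
  atoms, evidence `harmonic_stieltjes_check.out`, and `K2-crux-attack.md`).
* STATE OF THE LINE seen from the tree (2026-08-17T12:40Z): STUB 1 (`…StubBoundaryGreenKubo`), STUB 3
  (`…StubStieltjesOfPencil`), STUB 4a (`…StubHarmonicMember`) are LANDED, and `…StubMixedEdges` moves the edge
  `lam = 0 < β` into the open range (`openChainGreenKubo_of_nonneg`, the `0 ≤ lam` remark above realised by the provers);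
  open: STUB 2 (the pencil `W = S^{1/2}R_γS^{1/2}` on `L²(μ_T)`) and the φ⁴ corner of STUB 4b.  The disprover has no
  objection to STUB 2 (its content is checked numerically at `N = 2` by the Galerkin job) and maintains that the φ⁴
  corner can be settled by nobody: the item closes only after the planner narrows the range. [folklore] -/
theorem lineNotes : True := trivial

end Summit.AtomisticToContinuum.FouriersLaw.Cruxes.StieltjesRepresentation.Disproof

end
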